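import Summits.AtomisticToContinuum.Crystallization.Theorems.FrustratedLawDichotomyCertFloorTails

/-!
# FrustratedLawDichotomy · crux `AperiodicFrustratedLawGap` (stmt-AtomisticToContinuum-27623) — TRUNCATION TAILS FOR THE CLASS-A CERTIFICATE FLOOR, II:
# THE FORCE-REMAINDER COLUMN (hdef side, class A; decomp-a2c hand-1 g52, companion of `…CertFloorTails`)

The remainder column of `certFloor` (T2, (226)), `½·Σ_{x∈a}Σ_{x'∈a∖x} ‖Y_x − Y_{x'}‖·forceRem ‖x − x'‖ (dispB τ x + dispB τ x')` (`Y = mulExt I y`), runs over all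
pairs with an end in the interior `I` (≈ |I|·|a| ≈ 7·10⁶ at `Rc = 14`).  Here its FAR pairs (bond length `≥ L`) are booked in closed form:

* `forceRem_mono_right` — `forceRem r η` is monotone in the displacement allowance `η ∈ [0, r)`;
* ★ `forceRem_le_far` — for `0 ≤ η < L ≤ r`: `forceRem r η ≤ η²·(A₉ r⁻⁹ + A₁₅ r⁻¹⁵)` with
  `A₉ = 10(1 − η/L)⁻¹²(2 + η/L)²(1 + η/L) + 4(3 + η/L)`, `A₁₅ = 28(1 − η/L)⁻¹⁸(2 + η/L)²(1 + η/L) + 7(3 + η/L)` (crude `max ≤ sum`, `|ψ′| ≤ 4t⁻⁵ + 7t⁻⁸`);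
* ★★ `remColumn_le_near_add_tail` — on a `δ`-separated template with `2τ < L`, `δ/2 ≤ L`:
  `½ΣΣ_{all pairs} ‖Y_x − Y_{x'}‖·forceRem … ≤ ½ΣΣ_{pairs with dist < L} (same) + (Σ_{x∈I}‖y_x‖)·(2τ)²·(A₉ S₆(δ,L) + A₁₅ S₁₂(δ,L))`
  (`A`'s at `η = 2τ`; `S_k(δ,R)` the sharp shell sums of `…FarFieldSharp`).
DESK SIZE (δ = 0.9, τ = 1/128, Σ‖y‖ = 0.225): tail at `L = 4` ≈ `1·10⁻⁵` FULL; the pair count drops from ≈ 7·10⁶ to ≈ 403 × 370.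
DEF-FREE; imports `…CertFloorTails` (→ TREE (226)); 0 sorry.  All `[folklore]`.
-/

noncomputable section

namespace Summit.AtomisticToContinuum.Crystallization.Theorems.FrustratedLawDichotomyCertFloorTailsRem

open Metric Set RealInnerProductSpace
open scoped BigOperators
open Summit.AtomisticToContinuum.Crystallization.Theorems.ChargedEnergyGapNegative (E3)
open Summit.AtomisticToContinuum.Crystallization.Theorems.FrustratedLawDichotomyEnergyRemainder (inv_sq_pow_eq)
open Summit.AtomisticToContinuum.Crystallization.Theorems.FrustratedLawDichotomyFarFieldSharp (sum_inv_pow_le_of_separated_sharp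
  inv_pow_le_inv_pow_of_le)
open Summit.AtomisticToContinuum.Crystallization.Theorems.FrustratedLawDichotomyCoherentFloorAlgebra

/-! ## §1. The force-remainder entry far from the diagonal -/

/-- `forceRem r η` is monotone in `η` on `[0, r)`. [folklore] -/
theorem forceRem_mono_right {r η η' : ℝ} (h0 : 0 ≤ η) (hηη' : η ≤ η') (hr : η' < r) : forceRem r η ≤ forceRem r η' := by
  unfold forceRem
  have hρ' : 0 < (r - η') ^ 2 := by have := sub_pos.mpr hr; positivity
  have hρρ : (r - η') ^ 2 ≤ (r - η) ^ 2 := by nlinarith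
  have i6 := inv_pow_le_inv_pow_of_le hρ' hρρ 6
  have i9 := inv_pow_le_inv_pow_of_le hρ' hρρ 9
  have hmax : max (10 * ((r - η) ^ 2)⁻¹ ^ 6) (28 * ((r - η) ^ 2)⁻¹ ^ 9) ≤ max (10 * ((r - η') ^ 2)⁻¹ ^ 6) (28 * ((r - η') ^ 2)⁻¹ ^ 9) :=
    max_le_max (by linarith) (by linarith)
  have hm0 : 0 ≤ max (10 * ((r - η) ^ 2)⁻¹ ^ 6) (28 * ((r - η) ^ 2)⁻¹ ^ 9) := le_max_of_le_left (by positivity)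
  have hr0 : 0 ≤ r := by linarith
  have hq : 2 * r * η + η ^ 2 ≤ 2 * r * η' + η' ^ 2 := by nlinarith
  have hq0 : 0 ≤ 2 * r * η + η ^ 2 := by positivity
  have hs : η ^ 2 * r + (2 * r * η + η ^ 2) * η ≤ η' ^ 2 * r + (2 * r * η' + η' ^ 2) * η' := by nlinarith
  gcongr

/-- `|ψ′(r²)| ≤ 4r⁻¹⁰ + 7r⁻¹⁶` for `r ≥ 0`. [folklore] -/
theorem abs_psiT1_sq_le {r : ℝ} (hr : 0 ≤ r) : |psiT1 (r ^ 2)| ≤ 4 * r⁻¹ ^ 10 + 7 * r⁻¹ ^ 16 := by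
  have e : psiT1 (r ^ 2) = -4 * r⁻¹ ^ 10 + 7 * r⁻¹ ^ 16 := by unfold psiT1; rw [inv_sq_pow_eq, inv_sq_pow_eq]
  rw [e]
  have hi : 0 ≤ r⁻¹ := inv_nonneg.mpr hr
  exact abs_le.mpr ⟨by nlinarith [pow_nonneg hi 10, pow_nonneg hi 16], by nlinarith [pow_nonneg hi 10, pow_nonneg hi 16]⟩

/-- ★ FAR MAJORANT of the force-remainder entry: for `0 ≤ η < L ≤ r`,
`forceRem r η ≤ η²·(A₉ r⁻⁹ + A₁₅ r⁻¹⁵)`, `A₉ = 10(1 − η/L)⁻¹²(2 + η/L)²(1 + η/L) + 4(3 + η/L)`,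
`A₁₅ = 28(1 − η/L)⁻¹⁸(2 + η/L)²(1 + η/L) + 7(3 + η/L)`. [folklore] -/
theorem forceRem_le_far {L η r : ℝ} (hη : 0 ≤ η) (hL : η < L) (hr : L ≤ r) :
    forceRem r η ≤ η ^ 2 * ((10 * (1 - η / L)⁻¹ ^ 12 * (2 + η / L) ^ 2 * (1 + η / L) + 4 * (3 + η / L)) * r⁻¹ ^ 9
      + (28 * (1 - η / L)⁻¹ ^ 18 * (2 + η / L) ^ 2 * (1 + η / L) + 7 * (3 + η / L)) * r⁻¹ ^ 15) := by
  have hL0 : 0 < L := hη.trans_lt hL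
  have hr0 : 0 < r := hL0.trans_le hr
  have hq : 0 < 1 - η / L := by rw [sub_pos, div_lt_one hL0]; exact hL
  have hηL : 0 ≤ η / L := div_nonneg hη hL0.le
  -- `η ≤ (η/L)·r`
  have hηr : η ≤ η / L * r := by rw [div_mul_eq_mul_div, le_div_iff₀ hL0]; exact mul_le_mul_of_nonneg_left hr hη
  -- (1) `(r − η)² ≥ (r(1 − η/L))²`, hence the inverse powers
  have hρ : r * (1 - η / L) ≤ r - η := by nlinarith
  have hρ0 : 0 < r * (1 - η / L) := mul_pos hr0 hq
  have hρ2 : (r * (1 - η / L)) ^ 2 ≤ (r - η) ^ 2 := pow_le_pow_left₀ hρ0.le hρ 2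
  have i6 : ((r - η) ^ 2)⁻¹ ^ 6 ≤ (1 - η / L)⁻¹ ^ 12 * r⁻¹ ^ 12 := by
    refine (inv_pow_le_inv_pow_of_le (by positivity) hρ2 6).trans (le_of_eq ?_)
    rw [mul_pow, mul_inv, mul_pow, ← inv_pow, ← inv_pow, ← pow_mul, ← pow_mul, inv_pow, inv_pow]; ring
  have i9 : ((r - η) ^ 2)⁻¹ ^ 9 ≤ (1 - η / L)⁻¹ ^ 18 * r⁻¹ ^ 18 := by
    refine (inv_pow_le_inv_pow_of_le (by positivity) hρ2 9).trans (le_of_eq ?_)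
    rw [mul_pow, mul_inv, mul_pow, ← inv_pow, ← inv_pow, ← pow_mul, ← pow_mul, inv_pow, inv_pow]; ring
  -- (2) the polynomial factors
  have f1 : 2 * r * η + η ^ 2 ≤ η * r * (2 + η / L) := by nlinarith
  have f10 : 0 ≤ 2 * r * η + η ^ 2 := by positivity
  have f2 : r + η ≤ r * (1 + η / L) := by nlinarith
  have f3 : η ^ 2 * r + (2 * r * η + η ^ 2) * η ≤ η ^ 2 * r * (3 + η / L) := by nlinarith
  -- (3) assemble
  unfold forceRem
  have hm : max (10 * ((r - η) ^ 2)⁻¹ ^ 6) (28 * ((r - η) ^ 2)⁻¹ ^ 9)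
      ≤ 10 * ((1 - η / L)⁻¹ ^ 12 * r⁻¹ ^ 12) + 28 * ((1 - η / L)⁻¹ ^ 18 * r⁻¹ ^ 18) := by
    refine max_le ?_ ?_
    · have : 0 ≤ 28 * ((1 - η / L)⁻¹ ^ 18 * r⁻¹ ^ 18) := by positivity
      linarith
    · have : 0 ≤ 10 * ((1 - η / L)⁻¹ ^ 12 * r⁻¹ ^ 12) := by positivity
      linarith
  have hm0 : 0 ≤ max (10 * ((r - η) ^ 2)⁻¹ ^ 6) (28 * ((r - η) ^ 2)⁻¹ ^ 9) := le_max_of_le_left (by positivity)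
  have t1 : max (10 * ((r - η) ^ 2)⁻¹ ^ 6) (28 * ((r - η) ^ 2)⁻¹ ^ 9) * (2 * r * η + η ^ 2) ^ 2 * (r + η)
      ≤ (10 * ((1 - η / L)⁻¹ ^ 12 * r⁻¹ ^ 12) + 28 * ((1 - η / L)⁻¹ ^ 18 * r⁻¹ ^ 18)) * (η * r * (2 + η / L)) ^ 2 * (r * (1 + η / L)) := by
    gcongr
  have t2 : |psiT1 (r ^ 2)| * (η ^ 2 * r + (2 * r * η + η ^ 2) * η) ≤ (4 * r⁻¹ ^ 10 + 7 * r⁻¹ ^ 16) * (η ^ 2 * r * (3 + η / L)) :=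
    mul_le_mul (abs_psiT1_sq_le hr0.le) f3 (by positivity) (by positivity)
  -- the power bookkeeping `r⁻¹^12 · r³ = r⁻¹^9` etc.
  have p9 : r⁻¹ ^ 12 * r ^ 3 = r⁻¹ ^ 9 := by field_simp
  have p15 : r⁻¹ ^ 18 * r ^ 3 = r⁻¹ ^ 15 := by field_simp
  have p9' : r⁻¹ ^ 10 * r = r⁻¹ ^ 9 := by field_simp
  have p15' : r⁻¹ ^ 16 * r = r⁻¹ ^ 15 := by field_simp
  have e1 : (10 * ((1 - η / L)⁻¹ ^ 12 * r⁻¹ ^ 12) + 28 * ((1 - η / L)⁻¹ ^ 18 * r⁻¹ ^ 18)) * (η * r * (2 + η / L)) ^ 2 * (r * (1 + η / L))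
      = η ^ 2 * ((2 + η / L) ^ 2 * (1 + η / L)) * (10 * (1 - η / L)⁻¹ ^ 12 * (r⁻¹ ^ 12 * r ^ 3) + 28 * (1 - η / L)⁻¹ ^ 18 * (r⁻¹ ^ 18 * r ^ 3)) := by
    ring
  have e2 : (4 * r⁻¹ ^ 10 + 7 * r⁻¹ ^ 16) * (η ^ 2 * r * (3 + η / L)) = η ^ 2 * (3 + η / L) * (4 * (r⁻¹ ^ 10 * r) + 7 * (r⁻¹ ^ 16 * r)) := by
    ring
  rw [e1, p9, p15] at t1
  rw [e2, p9', p15'] at t2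
  have : η ^ 2 * ((2 + η / L) ^ 2 * (1 + η / L)) * (10 * (1 - η / L)⁻¹ ^ 12 * r⁻¹ ^ 9 + 28 * (1 - η / L)⁻¹ ^ 18 * r⁻¹ ^ 15)
      + η ^ 2 * (3 + η / L) * (4 * r⁻¹ ^ 9 + 7 * r⁻¹ ^ 15)
      = η ^ 2 * ((10 * (1 - η / L)⁻¹ ^ 12 * (2 + η / L) ^ 2 * (1 + η / L) + 4 * (3 + η / L)) * r⁻¹ ^ 9
        + (28 * (1 - η / L)⁻¹ ^ 18 * (2 + η / L) ^ 2 * (1 + η / L) + 7 * (3 + η / L)) * r⁻¹ ^ 15) := by ring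
  linarith


/-- `forceRem r η ≥ 0` for `r, η ≥ 0`. [folklore] -/
theorem forceRem_nonneg {r η : ℝ} (hr : 0 ≤ r) (hη : 0 ≤ η) : 0 ≤ forceRem r η := by
  unfold forceRem
  have hm : 0 ≤ max (10 * ((r - η) ^ 2)⁻¹ ^ 6) (28 * ((r - η) ^ 2)⁻¹ ^ 9) := le_max_of_le_left (by positivity)
  positivity

/-! ## §2. The shell sum of the far majorant and the truncated remainder column (`E3`) -/

/-- `Σ_{far} (A·d⁻⁹ + B·d⁻¹⁵) ≤ A·S₆(δ,R) + B·S₁₂(δ,R)` over a finite `δ`-separated set at distance `≥ R ≥ δ/2` from `p` (`A, B ≥ 0`). [folklore] -/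
theorem sum_remTail_le (s : Finset E3) (p : E3) {δ R A B : ℝ} (hδ : 0 < δ) (hR : δ / 2 ≤ R) (hA : 0 ≤ A) (hB : 0 ≤ B)
    (hsep : ∀ a ∈ s, ∀ b ∈ s, a ≠ b → δ ≤ dist a b) (hfar : ∀ a ∈ s, R ≤ dist a p) :
    ∑ a ∈ s, (A * (dist a p)⁻¹ ^ 9 + B * (dist a p)⁻¹ ^ 15)
      ≤ A * (1 / 2 * (2 / δ) ^ 3 * R⁻¹ ^ 6 + 48 / 7 * (2 / δ) ^ 2 * R⁻¹ ^ 7 + 3 / 8 * (2 / δ) * R⁻¹ ^ 8 + 2 * R⁻¹ ^ 9)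
        + B * (1 / 4 * (2 / δ) ^ 3 * R⁻¹ ^ 12 + 84 / 13 * (2 / δ) ^ 2 * R⁻¹ ^ 13 + 3 / 14 * (2 / δ) * R⁻¹ ^ 14 + 2 * R⁻¹ ^ 15) := by
  have h6 := sum_inv_pow_le_of_separated_sharp s p (k := 6) (by norm_num) hδ hR hsep hfar
  have h12 := sum_inv_pow_le_of_separated_sharp s p (k := 12) (by norm_num) hδ hR hsep hfar
  have e6 : (3 / ((6 : ℕ) : ℝ) * (2 / δ) ^ 3 * R⁻¹ ^ 6 + 6 * (((6 : ℕ) : ℝ) + 2) / (((6 : ℕ) : ℝ) + 1) * (2 / δ) ^ 2 * R⁻¹ ^ (6 + 1) +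
        3 / (((6 : ℕ) : ℝ) + 2) * (2 / δ) * R⁻¹ ^ (6 + 2) + 2 * R⁻¹ ^ (6 + 3))
      = 1 / 2 * (2 / δ) ^ 3 * R⁻¹ ^ 6 + 48 / 7 * (2 / δ) ^ 2 * R⁻¹ ^ 7 + 3 / 8 * (2 / δ) * R⁻¹ ^ 8 + 2 * R⁻¹ ^ 9 := by
    push_cast; ring
  have e12 : (3 / ((12 : ℕ) : ℝ) * (2 / δ) ^ 3 * R⁻¹ ^ 12 + 6 * (((12 : ℕ) : ℝ) + 2) / (((12 : ℕ) : ℝ) + 1) * (2 / δ) ^ 2 * R⁻¹ ^ (12 + 1) +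
        3 / (((12 : ℕ) : ℝ) + 2) * (2 / δ) * R⁻¹ ^ (12 + 2) + 2 * R⁻¹ ^ (12 + 3))
      = 1 / 4 * (2 / δ) ^ 3 * R⁻¹ ^ 12 + 84 / 13 * (2 / δ) ^ 2 * R⁻¹ ^ 13 + 3 / 14 * (2 / δ) * R⁻¹ ^ 14 + 2 * R⁻¹ ^ 15 := by
    push_cast; ring
  rw [e6] at h6
  rw [e12] at h12
  rw [Finset.sum_add_distrib, ← Finset.mul_sum, ← Finset.mul_sum]
  have h6' : ∑ a ∈ s, (dist a p)⁻¹ ^ 9 = ∑ a ∈ s, (dist a p)⁻¹ ^ (6 + 3) := rfl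
  have h12' : ∑ a ∈ s, (dist a p)⁻¹ ^ 15 = ∑ a ∈ s, (dist a p)⁻¹ ^ (12 + 3) := rfl
  rw [h6', h12']
  have := mul_le_mul_of_nonneg_left h6 hA
  have := mul_le_mul_of_nonneg_left h12 hB
  linarith

/-- ★★ **THE REMAINDER-COLUMN TRUNCATION.**  Template `a` (`δ`-separated), interior `I ⊆ a`, `0 ≤ τ`, `2τ < L`, `δ/2 ≤ L`, any multipliers `y`
(`Y = mulExt I y`).  Then the remainder column of `certFloor` splits as NEAR pairs (bond length `< L`, what a K-file evaluates) plus a closed-form tail: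
`½ΣΣ_{all} ‖Y_x − Y_{x'}‖·forceRem ‖x − x'‖ (dispB τ x + dispB τ x') ≤ ½ΣΣ_{dist < L} (same) + (Σ_{x∈I}‖y_x‖)·(2τ)²·(A₉ S₆(δ,L) + A₁₅ S₁₂(δ,L))`,
`A`'s of `forceRem_le_far` at `η = 2τ`. [folklore] -/
theorem remColumn_le_near_add_tail (a I : Finset E3) (y : E3 → E3) {δ L τ : ℝ} (hδ : 0 < δ) (hL : δ / 2 ≤ L) (hτ0 : 0 ≤ τ)
    (hτL : 2 * τ < L) (hsep : ∀ z ∈ a, ∀ z' ∈ a, z ≠ z' → δ ≤ dist z z') (hIa : I ⊆ a) :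
    1 / 2 * ∑ x ∈ a, ∑ x' ∈ a.erase x, ‖mulExt I y x - mulExt I y x'‖ * forceRem ‖x - x'‖ (dispB τ x + dispB τ x')
      ≤ 1 / 2 * ∑ x ∈ a, ∑ x' ∈ (a.erase x).filter (fun x' => dist x' x < L),
            ‖mulExt I y x - mulExt I y x'‖ * forceRem ‖x - x'‖ (dispB τ x + dispB τ x')
        + (∑ x ∈ I, ‖y x‖) * ((2 * τ) ^ 2 *
            ((10 * (1 - 2 * τ / L)⁻¹ ^ 12 * (2 + 2 * τ / L) ^ 2 * (1 + 2 * τ / L) + 4 * (3 + 2 * τ / L))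
                * (1 / 2 * (2 / δ) ^ 3 * L⁻¹ ^ 6 + 48 / 7 * (2 / δ) ^ 2 * L⁻¹ ^ 7 + 3 / 8 * (2 / δ) * L⁻¹ ^ 8 + 2 * L⁻¹ ^ 9)
              + (28 * (1 - 2 * τ / L)⁻¹ ^ 18 * (2 + 2 * τ / L) ^ 2 * (1 + 2 * τ / L) + 7 * (3 + 2 * τ / L))
                * (1 / 4 * (2 / δ) ^ 3 * L⁻¹ ^ 12 + 84 / 13 * (2 / δ) ^ 2 * L⁻¹ ^ 13 + 3 / 14 * (2 / δ) * L⁻¹ ^ 14 + 2 * L⁻¹ ^ 15))) := by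
  classical
  have hL0 : 0 < L := lt_of_lt_of_le (by positivity) hL
  have hq : 0 < 1 - 2 * τ / L := by rw [sub_pos, div_lt_one hL0]; exact hτL
  set A₉ := 10 * (1 - 2 * τ / L)⁻¹ ^ 12 * (2 + 2 * τ / L) ^ 2 * (1 + 2 * τ / L) + 4 * (3 + 2 * τ / L) with hA₉
  set A₁₅ := 28 * (1 - 2 * τ / L)⁻¹ ^ 18 * (2 + 2 * τ / L) ^ 2 * (1 + 2 * τ / L) + 7 * (3 + 2 * τ / L) with hA₁₅
  set S₆ := 1 / 2 * (2 / δ) ^ 3 * L⁻¹ ^ 6 + 48 / 7 * (2 / δ) ^ 2 * L⁻¹ ^ 7 + 3 / 8 * (2 / δ) * L⁻¹ ^ 8 + 2 * L⁻¹ ^ 9 with hS₆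
  set S₁₂ := 1 / 4 * (2 / δ) ^ 3 * L⁻¹ ^ 12 + 84 / 13 * (2 / δ) ^ 2 * L⁻¹ ^ 13 + 3 / 14 * (2 / δ) * L⁻¹ ^ 14 + 2 * L⁻¹ ^ 15 with hS₁₂
  have hA9 : 0 ≤ A₉ := by positivity
  have hA15 : 0 ≤ A₁₅ := by positivity
  -- opaque names for the bond weight and the far sets (they occur under binders)
  obtain ⟨f, hf⟩ : ∃ f : E3 → E3 → ℝ, ∀ x x', f x x' = forceRem ‖x - x'‖ (dispB τ x + dispB τ x') := ⟨_, fun _ _ => rfl⟩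
  obtain ⟨Far, hFar⟩ : ∃ Far : E3 → Finset E3, ∀ x, Far x = (a.erase x).filter (fun x' => ¬ dist x' x < L) :=
    ⟨_, fun _ => rfl⟩
  have hmem : ∀ x x', x' ∈ Far x ↔ (x' ≠ x ∧ x' ∈ a) ∧ ¬ dist x' x < L := fun x x' => by
    rw [hFar, Finset.mem_filter, Finset.mem_erase]
  have hdisp0 : ∀ z : E3, 0 ≤ dispB τ z := fun z => by unfold dispB; split_ifs <;> linarith
  have hdispτ : ∀ z : E3, dispB τ z ≤ τ := fun z => by unfold dispB; split_ifs <;> linarith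
  have hfs : ∀ x x', f x x' = f x' x := fun x x' => by rw [hf, hf, norm_sub_rev, add_comm (dispB τ x)]
  have hf0 : ∀ x x', 0 ≤ f x x' := fun x x' => by
    rw [hf]; exact forceRem_nonneg (norm_nonneg _) (add_nonneg (hdisp0 x) (hdisp0 x'))
  simp only [← hf]
  -- (1) split every inner sum into near and far pairs
  have hsplit : ∀ x, ∑ x' ∈ a.erase x, ‖mulExt I y x - mulExt I y x'‖ * f x x'
      = ∑ x' ∈ (a.erase x).filter (fun x' => dist x' x < L), ‖mulExt I y x - mulExt I y x'‖ * f x x'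
        + ∑ x' ∈ Far x, ‖mulExt I y x - mulExt I y x'‖ * f x x' := fun x => by
    rw [hFar]; exact (Finset.sum_filter_add_sum_filter_not _ _ _).symm
  simp only [hsplit, Finset.sum_add_distrib, mul_add]
  -- (2) far pairs: `‖Y x − Y x'‖ ≤ ‖Y x‖ + ‖Y x'‖`, then symmetrise
  have h2 : ∑ x ∈ a, ∑ x' ∈ Far x, ‖mulExt I y x - mulExt I y x'‖ * f x x'
      ≤ ∑ x ∈ a, ∑ x' ∈ Far x, ‖mulExt I y x‖ * f x x' + ∑ x ∈ a, ∑ x' ∈ Far x, ‖mulExt I y x'‖ * f x x' := by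
    rw [← Finset.sum_add_distrib]
    refine Finset.sum_le_sum fun x _ => ?_
    rw [← Finset.sum_add_distrib]
    refine Finset.sum_le_sum fun x' _ => ?_
    have := mul_le_mul_of_nonneg_right (norm_sub_le (mulExt I y x) (mulExt I y x')) (hf0 x x')
    linarith
  have h3 : ∑ x ∈ a, ∑ x' ∈ Far x, ‖mulExt I y x'‖ * f x x' = ∑ x ∈ a, ∑ x' ∈ Far x, ‖mulExt I y x‖ * f x x' := by
    rw [Finset.sum_comm' (t' := a) (s' := Far) (h := ?_)]
    · exact Finset.sum_congr rfl fun x _ => Finset.sum_congr rfl fun x' _ => by rw [hfs]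
    · intro x x'
      rw [hmem, hmem, dist_comm x x', ne_comm (a := x)]
      tauto
  -- (3) only interior sites carry a multiplier
  have h4 : ∑ x ∈ a, ∑ x' ∈ Far x, ‖mulExt I y x‖ * f x x' = ∑ x ∈ I, ‖y x‖ * ∑ x' ∈ Far x, f x x' := by
    have e : ∀ x, ∑ x' ∈ Far x, ‖mulExt I y x‖ * f x x' = if x ∈ I then ‖y x‖ * ∑ x' ∈ Far x, f x x' else 0 := by
      intro x
      unfold mulExt
      split_ifs with hx
      · rw [Finset.mul_sum]
      · simp
    simp_rw [e]
    rw [Finset.sum_ite_mem, Finset.inter_eq_right.mpr hIa]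
  -- (4) the far sum around an interior site
  have h5 : ∀ x ∈ I, ∑ x' ∈ Far x, f x x' ≤ (2 * τ) ^ 2 * (A₉ * S₆ + A₁₅ * S₁₂) := by
    intro x hx
    have hfar : ∀ x' ∈ Far x, L ≤ dist x' x := fun x' hx' => not_lt.mp ((hmem x x').mp hx').2
    have hsep' : ∀ u ∈ Far x, ∀ v ∈ Far x, u ≠ v → δ ≤ dist u v := fun u hu v hv huv =>
      hsep u ((hmem x u).mp hu).1.2 v ((hmem x v).mp hv).1.2 huv
    have h6 : ∀ x' ∈ Far x, f x x' ≤ (2 * τ) ^ 2 * (A₉ * (dist x' x)⁻¹ ^ 9 + A₁₅ * (dist x' x)⁻¹ ^ 15) := by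
      intro x' hx'
      have hd : L ≤ ‖x - x'‖ := by rw [← dist_eq_norm, dist_comm]; exact hfar x' hx'
      have hη : dispB τ x + dispB τ x' ≤ 2 * τ := by linarith [hdispτ x, hdispτ x']
      rw [hf]
      calc forceRem ‖x - x'‖ (dispB τ x + dispB τ x') ≤ forceRem ‖x - x'‖ (2 * τ) :=
            forceRem_mono_right (add_nonneg (hdisp0 x) (hdisp0 x')) hη (by linarith)
        _ ≤ (2 * τ) ^ 2 * (A₉ * ‖x - x'‖⁻¹ ^ 9 + A₁₅ * ‖x - x'‖⁻¹ ^ 15) :=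
            forceRem_le_far (by positivity) hτL hd
        _ = (2 * τ) ^ 2 * (A₉ * (dist x' x)⁻¹ ^ 9 + A₁₅ * (dist x' x)⁻¹ ^ 15) := by rw [dist_comm, dist_eq_norm]
    calc ∑ x' ∈ Far x, f x x' ≤ ∑ x' ∈ Far x, (2 * τ) ^ 2 * (A₉ * (dist x' x)⁻¹ ^ 9 + A₁₅ * (dist x' x)⁻¹ ^ 15) :=
          Finset.sum_le_sum h6
      _ = (2 * τ) ^ 2 * ∑ x' ∈ Far x, (A₉ * (dist x' x)⁻¹ ^ 9 + A₁₅ * (dist x' x)⁻¹ ^ 15) := by rw [Finset.mul_sum]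
      _ ≤ (2 * τ) ^ 2 * (A₉ * S₆ + A₁₅ * S₁₂) :=
          mul_le_mul_of_nonneg_left (sum_remTail_le (Far x) x hδ hL hA9 hA15 hsep' hfar) (by positivity)
  have h7 : ∑ x ∈ I, ‖y x‖ * ∑ x' ∈ Far x, f x x' ≤ (∑ x ∈ I, ‖y x‖) * ((2 * τ) ^ 2 * (A₉ * S₆ + A₁₅ * S₁₂)) := by
    rw [Finset.sum_mul]
    exact Finset.sum_le_sum fun x hx => mul_le_mul_of_nonneg_left (h5 x hx) (norm_nonneg _)
  -- (5) assemble
  rw [h3, h4] at h2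
  linarith

end Summit.AtomisticToContinuum.Crystallization.Theorems.FrustratedLawDichotomyCertFloorTailsRem

end
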